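import Literature.NumberTheory.Transcendental.RoySmallValueProp65
import HarnessLib

/-!
# Roy's small value estimate for `𝔾ₐ × 𝔾ₘ` — §7 Step 3: the orbit `Z` seen inside another level, degree and height bounds

Topic `Literature/NumberTheory/Transcendental`. Part of the formalisation of the proof of Roy 2013,
Theorem 1.1 (named fact `roy2013_thm_1_1`, `RoySmallValueEstimates.lean`), seat B. Source: D. Roy,
*A small value estimate for `𝔾ₐ × 𝔾ₘ`*, Mathematika 59 (2013) 333–363 = arXiv:1301.0663, §7,
Step 3 (p. 19 of the arXiv text):

> Denote by `D*` the smallest positive integer for which `Z ⊆ 𝒵(𝒟ⁱP̃_{D*+1} ; 0 ≤ i < 2⌊(D*+1)^τ⌋)`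
> [...] by Proposition 6.5, we conclude that `deg(Z) ≤ (D*+1)²/⌊(D*+1)^τ⌋ ≤ 2(D*)^{2−τ}` and
> `h(Z) ≤ 6(D*+1)^{1+β}/⌊(D*+1)^τ⌋ ≤ 7(D*)^{1+β−τ}`.

The orbit `O = orb i₀` of a configuration `Z : ZeroConfigK K ι` (found at level `D`) is compared
with the level package `L'` of ANOTHER degree `D'` (parallel seat's `LevelPkg`; same field `K`):
if the points of `O` lie in the chart `α₀α₂ ≠ 0` and `𝒟ᵏP̃'` vanishes at them for `k < T' + D'`,
then they are common zeros of `P̃', Q'`, hence — both systems of representatives being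
PIVOT-normalised — they ARE representatives of `L'` (`eq_of_smul_of_piv`, `exists_index_eq`), with
the same `K`-heights; Proposition 6.5 for `L'` (`RoySmallValueProp65`) then gives
(`ZeroConfigK.step3_bounds`)

  `T' · #O ≤ D'²`  and  `T' · D' · ∑_{j∈O} h_K(rep j) ≤ [K:ℚ] · log 𝓛(Φ(P̃', Q', ·))`.

Everything is proved; no definitions, no named facts.

## References

* [Roy2013] D. Roy, *A small value estimate for 𝔾ₐ × 𝔾ₘ*, Mathematika 59 (2013), 333–363
  (arXiv:1301.0663), §7, Step 3 and Proposition 6.5.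
-/

noncomputable section

open MvPolynomial Finset Height

namespace Literature.NumberTheory.Transcendental

namespace Roy2013

/-! ### Pivot-normalised representatives are canonical -/

/-- **Two proportional pivot-normalised vectors are equal.** [cite: Roy2013, §6, proof of Prop. 6.4 (normalised representatives)] -/
theorem eq_of_smul_of_piv {α β : Fin 3 → ℂ} {pα pβ : Fin 3} (hα1 : α pα = 1)
    (hαmin : ∀ k, α k ≠ 0 → pα ≤ k) (hβ1 : β pβ = 1) (hβmin : ∀ k, β k ≠ 0 → pβ ≤ k)
    {s : ℂ} (h : β = s • α) : β = α := by
  have hs : s ≠ 0 := by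
    intro hs; rw [hs, zero_smul] at h
    have := hβ1; rw [h, Pi.zero_apply] at this; exact zero_ne_one this
  -- the pivots coincide
  have hβk : ∀ k, β k = s * α k := fun k => by rw [h, Pi.smul_apply, smul_eq_mul]
  have h1 : pα ≤ pβ := hαmin pβ (by
    intro h0; have := hβ1; rw [hβk, h0, mul_zero] at this; exact zero_ne_one this)
  have h2 : pβ ≤ pα := hβmin pα (by rw [hβk, hα1, mul_one]; exact hs)
  have hp : pα = pβ := le_antisymm h1 h2
  -- hence `s = 1`
  have hs1 : s = 1 := by
    have := hβ1; rwa [← hp, hβk, hα1, mul_one] at this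
  rw [h, hs1, one_smul]

namespace ZeroConfigK

variable {K : IntermediateField ℚ ℂ} {ι : Type*} [Fintype ι] [DecidableEq ι] (Z : ZeroConfigK K ι)

omit [DecidableEq ι] in
/-- **A point of the configuration which is a common zero of `P̃', Q'` is a representative of the
level package `L'`.** [cite: Roy2013, §7, Step 3 (the same `Z` at the levels `D` and `D*+1`)] -/
theorem exists_index_eq {D' : ℕ} {Pt' : MvPolynomial (Fin 3) ℤ} (L' : LevelPkg D' Pt') (j : ι)
    (hP : eval (Z.α j) (map (Int.castRingHom ℂ) Pt') = 0)
    (hQ : eval (Z.α j) (map (Int.castRingHom ℂ) (levelQ D' Pt' L'.t)) = 0) :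
    ∃ i : Fin L'.m, L'.α i = Z.α j := by
  obtain ⟨i, s, hs⟩ := L'.cov (Z.α j) (Z.α_ne_zero j) hP hQ
  exact ⟨i, (eq_of_smul_of_piv (L'.piv_one i) (L'.piv_min i) (Z.piv_one j) (Z.piv_min j) hs).symm⟩

variable [NumberField K]

/-- **Roy 2013, §7 Step 3 via Proposition 6.5**: degree and height of the orbit `O = orb i₀`
measured inside the level package `L'` of degree `D'`. [cite: Roy2013, §7, Step 3; Proposition 6.5] -/
theorem step3_bounds (i₀ : ι) {D' : ℕ} {Pt' : MvPolynomial (Fin 3) ℤ} (L' : LevelPkg D' Pt')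
    (hPt' : (map (Int.castRingHom ℂ) Pt').IsHomogeneous D') (hK' : ∀ i k, L'.α i k ∈ K)
    {Li T' : ℕ} (hT₁ : (Li + 1).choose 2 < T') (hT₂ : T' ≤ (Li + 2).choose 2) (hLD : Li < D')
    (h0 : ∀ j ∈ Z.orb i₀, Z.α j 0 ≠ 0) (h2 : ∀ j ∈ Z.orb i₀, Z.α j 2 ≠ 0)
    (hvan : ∀ j ∈ Z.orb i₀, ∀ k < T' + D',
      eval (Z.α j) (homD^[k] (map (Int.castRingHom ℂ) Pt')) = 0) :
    T' * (Z.orb i₀).card ≤ D' ^ 2 ∧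
      (T' : ℝ) * (D' * ∑ j ∈ Z.orb i₀, logHeight (Z.rep j)) ≤
        Module.finrank ℚ K * Real.log (∑ m ∈ L'.intF.support, |((coeff m L'.intF : ℤ) : ℝ)|) := by
  classical
  have hT'1 : 1 ≤ T' := by have := Nat.zero_le ((Li + 1).choose 2); omega
  -- the points of `O` are common zeros of `P̃', Q'`
  have hP : ∀ j ∈ Z.orb i₀, eval (Z.α j) (map (Int.castRingHom ℂ) Pt') = 0 := fun j hj => by
    have := hvan j hj 0 (by omega); simpa using this
  have hQ : ∀ j ∈ Z.orb i₀, eval (Z.α j) (map (Int.castRingHom ℂ) (levelQ D' Pt' L'.t)) = 0 := by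
    intro j hj
    rw [map_levelQ, map_sum]
    refine Finset.sum_eq_zero fun i hi => ?_
    rw [smul_eq_C_mul, map_mul, show (eval (Z.α j)) (homD^[i] (map (Int.castRingHom ℂ) Pt')) = 0 from
      hvan j hj i (by have := (mem_Icc.mp hi).2; omega), mul_zero]
  -- the index map `φ : O → Fin L'.m`
  have hidx : ∀ j ∈ Z.orb i₀, ∃ i : Fin L'.m, L'.α i = Z.α j := fun j hj =>
    Z.exists_index_eq L' j (hP j hj) (hQ j hj)
  haveI : Nonempty (Fin L'.m) := ⟨(hidx i₀ (Z.self_mem_orb i₀)).choose⟩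
  choose! φ hφ using hidx
  have hφinj : Set.InjOn φ (Z.orb i₀ : Set ι) := by
    intro j hj j' hj' hjj'
    by_contra hne
    have h1 : Z.α j' = (1 : ℂ) • Z.α j := by rw [one_smul, ← hφ j hj, ← hφ j' hj', hjj']
    exact Z.sep j j' hne ⟨1, h1⟩
  obtain ⟨S, hS⟩ : ∃ S : Finset (Fin L'.m), S = (Z.orb i₀).image φ := ⟨_, rfl⟩
  have hScard : S.card = (Z.orb i₀).card := by rw [hS, card_image_of_injOn hφinj]
  -- hypotheses of Prop. 6.5 on `S`
  have hS0 : ∀ i ∈ S, L'.α i 0 ≠ 0 := by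
    intro i hi; obtain ⟨j, hj, rfl⟩ := mem_image.mp (hS ▸ hi); rw [hφ j hj]; exact h0 j hj
  have hS2 : ∀ i ∈ S, L'.α i 2 ≠ 0 := by
    intro i hi; obtain ⟨j, hj, rfl⟩ := mem_image.mp (hS ▸ hi); rw [hφ j hj]; exact h2 j hj
  have hSvan : ∀ i ∈ S, ∀ k < T' + D', eval (L'.α i) (homD^[k] (map (Int.castRingHom ℂ) Pt')) = 0 := by
    intro i hi k hk; obtain ⟨j, hj, rfl⟩ := mem_image.mp (hS ▸ hi); rw [hφ j hj]; exact hvan j hj k hk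
  constructor
  · have h := L'.mul_card_le_sq hPt' hT₁ hT₂ hLD S hS0 hS2 hSvan
    rwa [hScard] at h
  · have h := L'.mul_sum_height_le hPt' hT₁ hT₂ hLD K hK' S hS0 hS2 hSvan
    -- the heights agree: `rep' (φ j) = rep j` in `K³`
    have hrep : ∀ j ∈ Z.orb i₀, (L'.cfg K hK').rep (φ j) = Z.rep j := by
      intro j hj
      funext k
      apply Subtype.ext
      change L'.α (φ j) k = Z.α j k
      rw [hφ j hj]
    have hsum : ∑ i ∈ S, logHeight ((L'.cfg K hK').rep i) = ∑ j ∈ Z.orb i₀, logHeight (Z.rep j) := by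
      rw [hS, sum_image hφinj]
      exact Finset.sum_congr rfl fun j hj => by rw [hrep j hj]
    rwa [hsum] at h

end ZeroConfigK

end Roy2013

end Literature.NumberTheory.Transcendental
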